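import Mathlib
import HarnessLib
import Summits.ValiantsHypothesis.ValiantsHypothesis.Theses.MonotoneRestoration
import Literature.Computability.AlgebraicComplexity.ArithCircuit
import Literature.Computability.AlgebraicComplexity.ArithCircuitProofs
import Literature.Computability.AlgebraicComplexity.MonotoneStructure
import Literature.Computability.AlgebraicComplexity.PermanentIrreducible
import Literature.ModelTheory.FiniteModelTheory.CkEquiv
import Summits.ValiantsHypothesis.ValiantsHypothesis.Theorems.MonotoneRestorationMonotoneRestorationQPCosetCount
import Summits.ValiantsHypothesis.ValiantsHypothesis.Theorems.MonotoneRestorationMonotoneRestorationQPSymmetricLB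
import Summits.ValiantsHypothesis.ValiantsHypothesis.Theorems.MonotoneRestorationMonotoneRestorationQPSupportSymmetrisation
import Summits.ValiantsHypothesis.ValiantsHypothesis.Theorems.MonotoneRestorationMonotoneRestorationQPSparseRegime
import Summits.ValiantsHypothesis.ValiantsHypothesis.Theorems.MonotoneRestorationMonotoneRestorationQPBeta
import Literature.Computability.AlgebraicComplexity.SymmetricArithCircuit
import Literature.Computability.AlgebraicComplexity.DawarWilsenach2025Proofs
import Literature.GroupTheory.PermutationGroups.SmallIndexSubgroups
import Summits.ValiantsHypothesis.ValiantsHypothesis.Theorems.MonotoneRestorationQP.Negative.LoadBearing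
import Summits.ValiantsHypothesis.ValiantsHypothesis.Theorems.MonotoneRestorationMonotoneRestorationQPPermSupportCount

/-! TTRL-lite variant V18930 of stmt-ValiantsHypothesis-15886 -/

-- `ValiantsHypothesis.ValiantsHypothesis`: the D-0017 layout repeats the problem name in the path.
set_option linter.dupNamespace false

namespace Summit.ValiantsHypothesis.ValiantsHypothesis.Theorems

open Summit.ValiantsHypothesis.ValiantsHypothesis.Theses.MonotoneRestoration
open Literature.Computability.AlgebraicComplexity

/-- **Addition gates over `ℝ≥0` absorb the supports of their children** (TTRL-lite variant V18930,
lemma proposal, of `stub_mulGate_children_extend`). If `P` is a `+`-gate of a labelled arithmetic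
circuit over `ℝ≥0`, then `eval P = ∑_{h ∈ children P} eval h` (`eval_of_label_add`), and since
nothing cancels over `ℝ≥0` (`coeff_le_coeff_sum`) every monomial of a child `h` is a monomial of
`P`: `support (eval h) ⊆ support (eval P)`. Hence a support-extension property of `P` descends to
every child of a `+`-gate with the same shift `μ`. [folklore] -/
theorem stub_mulGate_children_extend_var18930 :
    ∀ (n : ℕ) (G : Type) (C : LabelledArithCircuit NNReal (Fin n × Fin n) Unit G) (P : G),
      C.label P = .add → ∀ h ∈ C.children P, (C.eval h).support ⊆ (C.eval P).support := by
  intro n G C P hP h hh m hm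
  rw [MvPolynomial.mem_support_iff] at hm ⊢
  rw [C.eval_of_label_add hP]
  intro h0
  apply hm
  have hle : MvPolynomial.coeff m (C.eval h) ≤
      MvPolynomial.coeff m (∑ b ∈ C.children P, C.eval b) :=
    coeff_le_coeff_sum (C.children P) (fun x => C.eval x) hh m
  exact le_antisymm (hle.trans (le_of_eq h0)) zero_le

end Summit.ValiantsHypothesis.ValiantsHypothesis.Theorems
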